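import Mathlib
import HarnessLib
import Literature.MathematicalPhysics.QuantumLattice.HubbardGridCharacters
import Literature.MathematicalPhysics.QuantumLattice.HubbardGridCounterQuadratic
import Summits.HubbardSuperconductivity.HubbardSuperconductivity.Theorems.KLProgrammeKLRegimeTwoVolumeFrameDressingLastScale
import Summits.HubbardSuperconductivity.HubbardSuperconductivity.Theorems.KLProgrammeKLRegimeTwoVolumeSpatialMultiplierCharSum
import Summits.HubbardSuperconductivity.HubbardSuperconductivity.Theorems.KLProgrammeKLRegimeEngineV8E5TrivialOverlap

/-!
# Route `KLProgramme` — crux K3 ENGINE (stmt-HubbardSuperconductivity-20437 `KLRegimeEngineV17F2`), stub (e) proof-input «(e)-D-ROWS», keying (A′) (pen (R495)):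
# THE FOURIER BOOKKEEPING OF THE LAST-SCALE FRAME CONVERSION — overlap rows of (polynomial spatial multiplier) × (symbol) and the chain symbol's pin character sum,
# in terms of the `ℓ¹` norm `N_D` of the position kernel of the mismatch polynomial `D = K₂ ⊖ K₁` and the `ℓ¹` norm `ρ` of the `2M`-lattice character sum of the symbol
# (cell gate-hubbard-kl, seat hubbard-kl-k3c4-p1 g27, VL lane; file (1c) of the order of record (R495)(C), part 1; sequel of ✓ p733706 / p733965)

Below temperature `m − 1 = −κ_D·Ψ_{K₁}` (✓ `dressWeight_sub_one_eq_of_scale_le_pi_div`) and, by the same identity of k3c4-p2 (`mismatchResummed_eq_uvSymbolCT_of_scale_le_pi_div`),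
the chain symbol is `κ_D/(1+Ψ_{K₂}κ_D) − κ_D = −κ_D²·Ψ_{K₁}` EXACTLY (`chainSymbol_eq_of_scale_le_pi_div`).  Both are a SPATIAL multiplier (`D(p_k⃗)`, `D(p_k⃗)²`) times the
frame-`K₁` symbol, so (✓ `sum_norm_charSum_spatialMul_le`, character dictionary `rowSum_/colSum_overlapKernel_eq`, Young on the spatial torus, character orthogonality
`KLRegimeSplit.sum_norm_sum_prodTorusChar_eq`):

* §1 bookkeeping: `sum_norm_pinCharSum_eq` (pin character sums ARE product-torus character sums), `sum_norm_charSum_eval_eq` (`Σ_x‖Σ_k D(p_k)χ_k(x)‖ = L²·Σ_z‖Ď(z)‖`),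
  `sum_norm_charSum_eval_mul_eval_le` (Young for `D₁·D₂`), `sum_norm_charSum_eq_mul_gridSymbol_twoM` (at `N = 2M` the padded grid symbol has no padding);
* §2 **`rowSum_overlap_evalMul_le` / `colSum_overlap_evalMul_le`** (`≤ ‖c‖·βL²·N_D·ρ`) and **`colSum_overlap_one_add_evalMul_le`** (`≤ ε⁻¹ + ‖c‖·βL²·N_D·ρ`);
* §3 **`sum_norm_chainCharSum_le`** — the named datum `Xχ` of ✓ p733418 is `≤ N_D²·ρ/2`.

`N_D ≥ Σ_z ‖framePosKernel L D z‖` (`≤ coeffNorm 0 D`, Literature `sum_norm_framePosKernel_le`), `ρ ≥` the LHS of Literature `sum_sum_norm_charSum_gridSymbol_uvSymbolCT_le` at `N = 2M`;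
assembly into `hPe`/`hdualSp`: `…TwoVolumeDualRowsLastScaleFourier`.  Pure finite Fourier analysis; nothing asserts the (D) rows, (e), hVL, the window, K3 or superconductivity.
References: BGM 2006 §2.3 (2.21)–(2.24), §2.7 (2.71a), §3 (3.3) [cite: BenfattoGiulianiMastropietro2006]; Feldman–Salmhofer–Trubowitz 1996 §1.
-/
noncomputable section

namespace Summit.HubbardSuperconductivity.HubbardSuperconductivity.Theorems.TwoVolumeDefect

set_option linter.dupNamespace false -- summit = problem name (single-conjunct summit), D-0017

open Finset Complex Literature.MathematicalPhysics.QuantumLattice Literature.Probability.LatticeModels GrassmannAlgebra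
open Summit.HubbardSuperconductivity.HubbardSuperconductivity.Theorems.KLRegimeSplit
open Summit.HubbardSuperconductivity.HubbardSuperconductivity.Theorems.KLProgrammeLegKernels
open Summit.HubbardSuperconductivity.HubbardSuperconductivity.Theorems.TorusFourierL2
open scoped ComplexConjugate

/-! ## §1 Bookkeeping: pin character sums, position kernels of polynomials, the grid symbol at `N = 2M` -/

section Bookkeeping

variable {L M : ℕ} [NeZero L] [NeZero M]

/-- **The pin character sums of the (D) rows are product-torus character sums**: for every symbol `Φ` and base point `x₀`,
`Σ_{x₁} ‖Σ_k Φ(k)·(e^{iω_k(t_{x₁} − t_{x₀})}·χ_{k⃗}(x⃗₁ − x⃗₀))‖ = Σ_z ‖Σ_p χ_{p₁}(z₁)χ_{p₂}(z₂) • Φ(k(p))‖` (`β ≠ 0`; the fermionic phase is a character of the time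
dual torus times a unimodular factor that does not depend on `k`). [cite: BenfattoGiulianiMastropietro2006, §2.1 footnote 1] -/
theorem sum_norm_pinCharSum_eq {β : ℝ} (hβ : β ≠ 0) (Φ : FreqMomentum L M → ℂ) (x₀ : SpaceTimeIdx L M) :
    ∑ x₁ : SpaceTimeIdx L M, ‖∑ k : FreqMomentum L M, Φ k *
        (Complex.exp (((matsubaraFreq β M k.1 * (imagTime β M x₁.1 - imagTime β M x₀.1) : ℝ) : ℂ) * I) * torusChar k.2 (x₁.2 - x₀.2))‖ =
      ∑ z : TorusSite 1 (2 * M) × TorusSite 2 L, ‖∑ p : TorusSite 1 (2 * M) × TorusSite 2 L,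
        (torusChar p.1 z.1 * torusChar p.2 z.2) • Φ (⟨(p.1 0).val, ZMod.val_lt (p.1 0)⟩, p.2)‖ := by
  have hpt : ∀ x₁ : SpaceTimeIdx L M, ‖∑ k : FreqMomentum L M, Φ k *
      (Complex.exp (((matsubaraFreq β M k.1 * (imagTime β M x₁.1 - imagTime β M x₀.1) : ℝ) : ℂ) * I) * torusChar k.2 (x₁.2 - x₀.2))‖ =
      ‖∑ p : TorusSite 1 (2 * M) × TorusSite 2 L,
        (torusChar p.1 (fun _ : Fin 1 => ((x₁.1 : ℕ) : ZMod (2 * M)) - ((x₀.1 : ℕ) : ZMod (2 * M))) * torusChar p.2 (x₁.2 - x₀.2)) •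
          Φ (⟨(p.1 0).val, ZMod.val_lt (p.1 0)⟩, p.2)‖ := by
    intro x₁
    set u : ℂ := Complex.exp (((Real.pi * (1 - 2 * M) * (((x₁.1 : ℕ) : ℝ) - ((x₀.1 : ℕ) : ℝ)) / (2 * M) : ℝ) : ℂ) * I) with hu
    have hsum : ∑ k : FreqMomentum L M, Φ k *
        (Complex.exp (((matsubaraFreq β M k.1 * (imagTime β M x₁.1 - imagTime β M x₀.1) : ℝ) : ℂ) * I) * torusChar k.2 (x₁.2 - x₀.2)) =
        u * ∑ p : TorusSite 1 (2 * M) × TorusSite 2 L,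
          (torusChar p.1 (fun _ : Fin 1 => ((x₁.1 : ℕ) : ZMod (2 * M)) - ((x₀.1 : ℕ) : ZMod (2 * M))) * torusChar p.2 (x₁.2 - x₀.2)) •
            Φ (⟨(p.1 0).val, ZMod.val_lt (p.1 0)⟩, p.2) := by
      rw [Finset.mul_sum, ← sum_freqMomentum_eq_sum_prodTorus]
      refine Finset.sum_congr rfl fun k _ => ?_
      rw [exp_matsubara_phase_eq hβ, smul_eq_mul]
      have hk : (⟨(((k.1 : ℕ) : ZMod (2 * M))).val, ZMod.val_lt _⟩ : MatsubaraIdx M) = k.1 :=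
        Fin.ext (val_natCast_matsubaraIdx k.1)
      simp only
      rw [hk]
      ring
    rw [hsum, norm_mul, hu, Complex.norm_exp_ofReal_mul_I, one_mul]
  simp_rw [hpt]
  exact sum_spaceTime_eq_sum_prodTorus_fst (fun z : TorusSite 1 (2 * M) × TorusSite 2 L =>
    ‖∑ p : TorusSite 1 (2 * M) × TorusSite 2 L, (torusChar p.1 z.1 * torusChar p.2 z.2) • Φ (⟨(p.1 0).val, ZMod.val_lt (p.1 0)⟩, p.2)‖) x₀

omit [NeZero M] in
/-- **The spatial character sum of a polynomial symbol is `L²` times its position kernel** (up to a reflection): `Σ_x ‖Σ_k K(p_k)χ_k(x)‖ = L²·Σ_z ‖framePosKernel L K z‖`. -/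
theorem sum_norm_charSum_eval_eq (K : TrigPolyC4v) :
    ∑ x : TorusSite 2 L, ‖∑ k : TorusSite 2 L, (K.eval (latticeMomentum L k) : ℂ) * torusChar k x‖ =
      (L : ℝ) ^ 2 * ∑ z : TorusSite 2 L, ‖framePosKernel L K z‖ := by
  have hL : (0 : ℝ) < (L : ℝ) ^ 2 := by have := NeZero.pos L; positivity
  have hLc : ‖((L : ℂ) ^ 2)⁻¹‖ = ((L : ℝ) ^ 2)⁻¹ := by rw [norm_inv, norm_pow, Complex.norm_natCast]
  have hrefl : ∑ z : TorusSite 2 L, ‖framePosKernel L K z‖ = ∑ z : TorusSite 2 L, ‖framePosKernel L K (-z)‖ :=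
    (Fintype.sum_equiv (Equiv.neg _) _ _ fun z => rfl).symm
  rw [hrefl, Finset.mul_sum]
  refine Finset.sum_congr rfl fun z _ => ?_
  simp only [framePosKernel, torusChar_neg_right, Complex.conj_conj, norm_mul, hLc]
  rw [← mul_assoc, mul_inv_cancel₀ hL.ne', one_mul]

omit [NeZero M] in
/-- **Young on the spatial torus**: `Σ_x ‖Σ_k K₁(p_k)K₂(p_k)χ_k(x)‖ ≤ L²·(Σ_z‖Ǩ₁(z)‖)·(Σ_z‖Ǩ₂(z)‖)` (`TorusFourierWeightedConvolution.sum_mul_norm_torusFourierInv_mul_le`,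
weight `1`). [cite: BenfattoGiulianiMastropietro2006, §3 (3.3)] -/
theorem sum_norm_charSum_eval_mul_eval_le (K₁ K₂ : TrigPolyC4v) :
    ∑ x : TorusSite 2 L, ‖∑ k : TorusSite 2 L, ((K₁.eval (latticeMomentum L k) : ℂ) * (K₂.eval (latticeMomentum L k) : ℂ)) * torusChar k x‖ ≤
      (L : ℝ) ^ 2 * (∑ z : TorusSite 2 L, ‖framePosKernel L K₁ z‖) * ∑ z : TorusSite 2 L, ‖framePosKernel L K₂ z‖ := by
  have hL : (0 : ℝ) < (L : ℝ) ^ 2 := by have := NeZero.pos L; positivity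
  have hLc : ‖((L : ℂ) ^ 2)‖ = (L : ℝ) ^ 2 := by rw [norm_pow, Complex.norm_natCast]
  have h1 := sum_norm_charSum_eval_eq (L := L) K₁
  have h2 := sum_norm_charSum_eval_eq (L := L) K₂
  simp_rw [sum_mul_torusChar_eq_mul_torusFourierInv, norm_mul, hLc, ← Finset.mul_sum] at h1 h2 ⊢
  have hconv := sum_mul_norm_torusFourierInv_mul_le (w := fun _ : TorusSite 2 L => (1 : ℝ)) (fun _ => zero_le_one)
    (fun _ _ => by rw [one_mul]) (fun k : TorusSite 2 L => (K₁.eval (latticeMomentum L k) : ℂ)) (fun k => (K₂.eval (latticeMomentum L k) : ℂ))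
  simp only [one_mul] at hconv
  have e1 : ∑ z : TorusSite 2 L, ‖framePosKernel L K₁ z‖ = ∑ x : TorusSite 2 L, ‖torusFourierInv (fun k => (K₁.eval (latticeMomentum L k) : ℂ)) x‖ :=
    (mul_left_cancel₀ hL.ne' h1).symm
  have e2 : ∑ z : TorusSite 2 L, ‖framePosKernel L K₂ z‖ = ∑ x : TorusSite 2 L, ‖torusFourierInv (fun k => (K₂.eval (latticeMomentum L k) : ℂ)) x‖ :=
    (mul_left_cancel₀ hL.ne' h2).symm
  rw [e1, e2, mul_assoc]
  exact mul_le_mul_of_nonneg_left hconv hL.le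

omit [NeZero L] in
/-- **At `N = 2M` the padded grid symbol has no padding**: `gridSymbol L M (2M) β p σ q₀ q⃗ = (βL²)⁻²·p((⟨val q₀⟩, q⃗), σ)`. -/
theorem gridSymbol_twoM_eq (β : ℝ) (p : FreqMomentum L M × Fin 2 → ℂ) (σ : Fin 2) (q₀ : TorusSite 1 (2 * M)) (qv : TorusSite 2 L) :
    gridSymbol L M (2 * M) β p σ q₀ qv = ((1 / (β * (L : ℝ) ^ 2) : ℝ) : ℂ) ^ 2 * p ((⟨(q₀ 0).val, ZMod.val_lt (q₀ 0)⟩, qv), σ) := by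
  rw [gridSymbol, dif_pos (ZMod.val_lt (q₀ 0))]

/-- **The character sum of the symbol on the `2M` lattice is `(βL²)²` times the grid character sum at `N = 2M`**:
`Σ_z ‖Σ_p χ_{p₁}(z₁)χ_{p₂}(z₂) • p((k(p)), σ)‖ = (βL²)²·Σ_a Σ_b ‖Σ_{q₀} Σ_{q⃗} χ_{q₀}(a)χ_{q⃗}(b)·gridSymbol L M (2M) β p σ q₀ q⃗‖` (`β ≠ 0`). -/
theorem sum_norm_charSum_eq_mul_gridSymbol_twoM {β : ℝ} (hβ : β ≠ 0) (p : FreqMomentum L M × Fin 2 → ℂ) (σ : Fin 2) :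
    ∑ z : TorusSite 1 (2 * M) × TorusSite 2 L, ‖∑ q : TorusSite 1 (2 * M) × TorusSite 2 L,
        (torusChar q.1 z.1 * torusChar q.2 z.2) • p ((⟨(q.1 0).val, ZMod.val_lt (q.1 0)⟩, q.2), σ)‖ =
      (β * (L : ℝ) ^ 2) ^ 2 * ∑ a : TorusSite 1 (2 * M), ∑ bv : TorusSite 2 L,
        ‖∑ q₀ : TorusSite 1 (2 * M), ∑ qv : TorusSite 2 L, torusChar q₀ a * torusChar qv bv * gridSymbol L M (2 * M) β p σ q₀ qv‖ := by
  have hL : (0 : ℝ) < L := Nat.cast_pos.2 (NeZero.pos L)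
  have hc : (β * (L : ℝ) ^ 2) ≠ 0 := mul_ne_zero hβ (by positivity)
  have hnc : ‖(((1 / (β * (L : ℝ) ^ 2) : ℝ) : ℂ) ^ 2)‖ = ((β * (L : ℝ) ^ 2) ^ 2)⁻¹ := by
    rw [norm_pow, Complex.norm_real, Real.norm_eq_abs, one_div, abs_inv, inv_pow, sq_abs]
  rw [Fintype.sum_prod_type, Finset.mul_sum]
  refine Finset.sum_congr rfl fun a _ => ?_
  rw [Finset.mul_sum]
  refine Finset.sum_congr rfl fun bv _ => ?_
  simp_rw [gridSymbol_twoM_eq]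
  rw [Fintype.sum_prod_type]
  have hre : ∑ q₀ : TorusSite 1 (2 * M), ∑ qv : TorusSite 2 L, torusChar q₀ a * torusChar qv bv *
      ((((1 / (β * (L : ℝ) ^ 2) : ℝ) : ℂ) ^ 2) * p ((⟨(q₀ 0).val, ZMod.val_lt (q₀ 0)⟩, qv), σ)) =
      (((1 / (β * (L : ℝ) ^ 2) : ℝ) : ℂ) ^ 2) * ∑ q₀ : TorusSite 1 (2 * M), ∑ qv : TorusSite 2 L,
        (torusChar q₀ a * torusChar qv bv) • p ((⟨(q₀ 0).val, ZMod.val_lt (q₀ 0)⟩, qv), σ) := by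
    rw [Finset.mul_sum]
    refine Finset.sum_congr rfl fun q₀ _ => ?_
    rw [Finset.mul_sum]
    refine Finset.sum_congr rfl fun qv _ => ?_
    rw [smul_eq_mul]; ring
  rw [hre, norm_mul, hnc, ← mul_assoc, mul_inv_cancel₀ (pow_ne_zero _ hc), one_mul]

/-- Pulling a scalar out of a character sum: `Σ_z‖Σ_q χ_q(z) • (c·Φ(q))‖ = ‖c‖·Σ_z‖Σ_q χ_q(z) • Φ(q)‖`. -/
theorem sum_norm_charSum_const_mul (c : ℂ) (Φ : TorusSite 1 (2 * M) × TorusSite 2 L → ℂ) :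
    ∑ z : TorusSite 1 (2 * M) × TorusSite 2 L, ‖∑ q : TorusSite 1 (2 * M) × TorusSite 2 L, (torusChar q.1 z.1 * torusChar q.2 z.2) • (c * Φ q)‖ =
      ‖c‖ * ∑ z : TorusSite 1 (2 * M) × TorusSite 2 L, ‖∑ q : TorusSite 1 (2 * M) × TorusSite 2 L, (torusChar q.1 z.1 * torusChar q.2 z.2) • Φ q‖ := by
  rw [Finset.mul_sum]
  refine Finset.sum_congr rfl fun z _ => ?_
  rw [← norm_mul, Finset.mul_sum]
  congr 1
  refine Finset.sum_congr rfl fun q _ => ?_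
  simp only [smul_eq_mul]; ring

/-- Character sums are additive in the symbol: `Σ_z‖CS(Φ₁ + Φ₂)(z)‖ ≤ Σ_z‖CS(Φ₁)(z)‖ + Σ_z‖CS(Φ₂)(z)‖`. -/
theorem sum_norm_charSum_add_le (Φ₁ Φ₂ : TorusSite 1 (2 * M) × TorusSite 2 L → ℂ) :
    ∑ z : TorusSite 1 (2 * M) × TorusSite 2 L, ‖∑ q : TorusSite 1 (2 * M) × TorusSite 2 L, (torusChar q.1 z.1 * torusChar q.2 z.2) • (Φ₁ q + Φ₂ q)‖ ≤
      ∑ z : TorusSite 1 (2 * M) × TorusSite 2 L, ‖∑ q : TorusSite 1 (2 * M) × TorusSite 2 L, (torusChar q.1 z.1 * torusChar q.2 z.2) • Φ₁ q‖ +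
        ∑ z : TorusSite 1 (2 * M) × TorusSite 2 L, ‖∑ q : TorusSite 1 (2 * M) × TorusSite 2 L, (torusChar q.1 z.1 * torusChar q.2 z.2) • Φ₂ q‖ := by
  rw [← Finset.sum_add_distrib]
  refine Finset.sum_le_sum fun z _ => ?_
  simp_rw [smul_add, Finset.sum_add_distrib]
  exact norm_add_le _ _

end Bookkeeping

/-! ## §2 Overlap rows of a spatial multiplier times a symbol: `≤ ‖c‖·βL²·N_D·ρ` -/

section Overlap

variable {L M : ℕ} [NeZero L] [NeZero M] {N' : ℕ}

/-- **The character sum of (polynomial spatial multiplier) × (scalar) × (symbol)** is at most `‖c‖·(βL²)²·N_D·ρ`, where `N_D ≥ Σ_z‖Ď(z)‖` and `ρ ≥` the grid character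
sum of the symbol at `N = 2M` (spin `τ`). [cite: BenfattoGiulianiMastropietro2006, §3 (3.3)] -/
theorem sum_norm_charSum_evalMul_le {β : ℝ} (hβ : β ≠ 0) (Dm : TrigPolyC4v) (Ψ : FreqMomentum L M × Fin 2 → ℂ) (c : ℂ) (τ : Fin 2) {N_D ρ : ℝ}
    (hND : ∑ z : TorusSite 2 L, ‖framePosKernel L Dm z‖ ≤ N_D)
    (hρ : ∑ a : TorusSite 1 (2 * M), ∑ bv : TorusSite 2 L, ‖∑ q₀ : TorusSite 1 (2 * M), ∑ qv : TorusSite 2 L,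
      torusChar q₀ a * torusChar qv bv * gridSymbol L M (2 * M) β Ψ τ q₀ qv‖ ≤ ρ) :
    ∑ z : TorusSite 1 (2 * M) × TorusSite 2 L, ‖∑ q : TorusSite 1 (2 * M) × TorusSite 2 L, (torusChar q.1 z.1 * torusChar q.2 z.2) •
        ((Dm.eval (latticeMomentum L q.2) : ℂ) * (c * Ψ ((⟨(q.1 0).val, ZMod.val_lt (q.1 0)⟩, q.2), τ)))‖ ≤
      ‖c‖ * (β * (L : ℝ) ^ 2) ^ 2 * N_D * ρ := by
  have hL : (0 : ℝ) < (L : ℝ) ^ 2 := by have := NeZero.pos L; positivity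
  have hsplit := sum_norm_charSum_spatialMul_le (P := 2 * M) (fun kv : TorusSite 2 L => (Dm.eval (latticeMomentum L kv) : ℂ))
    (fun q : TorusSite 1 (2 * M) × TorusSite 2 L => c * Ψ ((⟨(q.1 0).val, ZMod.val_lt (q.1 0)⟩, q.2), τ))
  have hD : ((L : ℝ) ^ 2)⁻¹ * ∑ x : TorusSite 2 L, ‖∑ kv : TorusSite 2 L, (Dm.eval (latticeMomentum L kv) : ℂ) * torusChar kv x‖ ≤ N_D := by
    rw [sum_norm_charSum_eval_eq, ← mul_assoc, inv_mul_cancel₀ hL.ne', one_mul]; exact hND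
  have hΨ : ∑ z : TorusSite 1 (2 * M) × TorusSite 2 L, ‖∑ q : TorusSite 1 (2 * M) × TorusSite 2 L, (torusChar q.1 z.1 * torusChar q.2 z.2) •
      (c * Ψ ((⟨(q.1 0).val, ZMod.val_lt (q.1 0)⟩, q.2), τ))‖ ≤ ‖c‖ * ((β * (L : ℝ) ^ 2) ^ 2 * ρ) := by
    rw [sum_norm_charSum_const_mul, sum_norm_charSum_eq_mul_gridSymbol_twoM hβ]
    exact mul_le_mul_of_nonneg_left (mul_le_mul_of_nonneg_left hρ (sq_nonneg _)) (norm_nonneg _)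
  have hN0 : 0 ≤ N_D := (sum_nonneg fun _ _ => norm_nonneg _).trans hND
  calc _ ≤ _ := hsplit
    _ = (((L : ℝ) ^ 2)⁻¹ * ∑ x : TorusSite 2 L, ‖∑ kv : TorusSite 2 L, (Dm.eval (latticeMomentum L kv) : ℂ) * torusChar kv x‖) *
          ∑ z : TorusSite 1 (2 * M) × TorusSite 2 L, ‖∑ q : TorusSite 1 (2 * M) × TorusSite 2 L, (torusChar q.1 z.1 * torusChar q.2 z.2) •
            (c * Ψ ((⟨(q.1 0).val, ZMod.val_lt (q.1 0)⟩, q.2), τ))‖ := by ring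
    _ ≤ N_D * (‖c‖ * ((β * (L : ℝ) ^ 2) ^ 2 * ρ)) :=
          mul_le_mul hD hΨ (sum_nonneg fun _ _ => norm_nonneg _) hN0
    _ = ‖c‖ * (β * (L : ℝ) ^ 2) ^ 2 * N_D * ρ := by ring

/-- **Row sums of the overlap kernel `E(F′)·S(1)` when the row weight is a polynomial spatial multiplier times a scalar times a symbol**:
`Σ_x ‖(E(F′)S(1))((y,(ω′,σ,c)),(x,(0,σ,c)))‖ ≤ ‖c‖·βL²·N_D·ρ`. [cite: BenfattoGiulianiMastropietro2006, §2.7 (2.71a)] -/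
theorem rowSum_overlap_evalMul_le {β : ℝ} (hβ : 0 < β) (F' : Fin N' → FreqMomentum L M → ℂ) (ω' : Fin N') (Dm : TrigPolyC4v)
    (Ψ : FreqMomentum L M × Fin 2 → ℂ) (c : ℂ) (τ : Fin 2)
    (hF : ∀ k : FreqMomentum L M, F' ω' k = (Dm.eval (latticeMomentum L k.2) : ℂ) * (c * Ψ (k, τ))) {N_D ρ : ℝ}
    (hND : ∑ z : TorusSite 2 L, ‖framePosKernel L Dm z‖ ≤ N_D)
    (hρ : ∑ a : TorusSite 1 (2 * M), ∑ bv : TorusSite 2 L, ‖∑ q₀ : TorusSite 1 (2 * M), ∑ qv : TorusSite 2 L,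
      torusChar q₀ a * torusChar qv bv * gridSymbol L M (2 * M) β Ψ τ q₀ qv‖ ≤ ρ)
    (σ cc : Fin 2) (y : SpaceTimeIdx L M) :
    ∑ x : SpaceTimeIdx L M, ‖(sectorAnalysisMatrix L M β F' * sectorSubMatrix L M β (trivialMultiplier L M)) (y, ((ω', σ), cc)) (x, ((0, σ), cc))‖ ≤
      ‖c‖ * (β * (L : ℝ) ^ 2) * N_D * ρ := by
  have hL : (0 : ℝ) < (L : ℝ) ^ 2 := by have := NeZero.pos L; positivity
  have hc0 : (0 : ℝ) < β * (L : ℝ) ^ 2 := by positivity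
  rw [rowSum_overlapKernel_eq hβ]
  have hsym : ∀ q : TorusSite 1 (2 * M) × TorusSite 2 L,
      F' ω' (⟨(q.1 0).val, ZMod.val_lt (q.1 0)⟩, q.2) * trivialMultiplier L M 0 (⟨(q.1 0).val, ZMod.val_lt (q.1 0)⟩, q.2) =
        (Dm.eval (latticeMomentum L q.2) : ℂ) * (c * Ψ ((⟨(q.1 0).val, ZMod.val_lt (q.1 0)⟩, q.2), τ)) := by
    intro q; rw [hF, trivialMultiplier, mul_one]
  simp_rw [hsym]
  calc 1 / (β * (L : ℝ) ^ 2) * _ ≤ 1 / (β * (L : ℝ) ^ 2) * (‖c‖ * (β * (L : ℝ) ^ 2) ^ 2 * N_D * ρ) :=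
        mul_le_mul_of_nonneg_left (sum_norm_charSum_evalMul_le hβ.ne' Dm Ψ c τ hND hρ) (by positivity)
    _ = ‖c‖ * (β * (L : ℝ) ^ 2) * N_D * ρ := by field_simp

/-- **Column sums**, same bound. [cite: BenfattoGiulianiMastropietro2006, §2.7 (2.71a)] -/
theorem colSum_overlap_evalMul_le {β : ℝ} (hβ : 0 < β) (F' : Fin N' → FreqMomentum L M → ℂ) (ω' : Fin N') (Dm : TrigPolyC4v)
    (Ψ : FreqMomentum L M × Fin 2 → ℂ) (c : ℂ) (τ : Fin 2)
    (hF : ∀ k : FreqMomentum L M, F' ω' k = (Dm.eval (latticeMomentum L k.2) : ℂ) * (c * Ψ (k, τ))) {N_D ρ : ℝ}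
    (hND : ∑ z : TorusSite 2 L, ‖framePosKernel L Dm z‖ ≤ N_D)
    (hρ : ∑ a : TorusSite 1 (2 * M), ∑ bv : TorusSite 2 L, ‖∑ q₀ : TorusSite 1 (2 * M), ∑ qv : TorusSite 2 L,
      torusChar q₀ a * torusChar qv bv * gridSymbol L M (2 * M) β Ψ τ q₀ qv‖ ≤ ρ)
    (σ cc : Fin 2) (x : SpaceTimeIdx L M) :
    ∑ y : SpaceTimeIdx L M, ‖(sectorAnalysisMatrix L M β F' * sectorSubMatrix L M β (trivialMultiplier L M)) (y, ((ω', σ), cc)) (x, ((0, σ), cc))‖ ≤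
      ‖c‖ * (β * (L : ℝ) ^ 2) * N_D * ρ := by
  have hL : (0 : ℝ) < (L : ℝ) ^ 2 := by have := NeZero.pos L; positivity
  have hc0 : (0 : ℝ) < β * (L : ℝ) ^ 2 := by positivity
  rw [colSum_overlapKernel_eq hβ]
  have hsym : ∀ q : TorusSite 1 (2 * M) × TorusSite 2 L,
      F' ω' (⟨(q.1 0).val, ZMod.val_lt (q.1 0)⟩, q.2) * trivialMultiplier L M 0 (⟨(q.1 0).val, ZMod.val_lt (q.1 0)⟩, q.2) =
        (Dm.eval (latticeMomentum L q.2) : ℂ) * (c * Ψ ((⟨(q.1 0).val, ZMod.val_lt (q.1 0)⟩, q.2), τ)) := by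
    intro q; rw [hF, trivialMultiplier, mul_one]
  simp_rw [hsym]
  calc 1 / (β * (L : ℝ) ^ 2) * _ ≤ 1 / (β * (L : ℝ) ^ 2) * (‖c‖ * (β * (L : ℝ) ^ 2) ^ 2 * N_D * ρ) :=
        mul_le_mul_of_nonneg_left (sum_norm_charSum_evalMul_le hβ.ne' Dm Ψ c τ hND hρ) (by positivity)
    _ = ‖c‖ * (β * (L : ℝ) ^ 2) * N_D * ρ := by field_simp

/-- **Column sums when the weight is `1 +` (polynomial spatial multiplier × scalar × symbol)**: `≤ ε⁻¹ + ‖c‖·βL²·N_D·ρ` (the constant part is the trivial overlap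
`E(1)S(1)`, whose columns are exactly `ε⁻¹ = 2M/β` by character orthogonality). [cite: BenfattoGiulianiMastropietro2006, §2.1 (2.5), §2.7 (2.71a)] -/
theorem colSum_overlap_one_add_evalMul_le {β : ℝ} (hβ : 0 < β) (F' : Fin N' → FreqMomentum L M → ℂ) (ω' : Fin N') (Dm : TrigPolyC4v)
    (Ψ : FreqMomentum L M × Fin 2 → ℂ) (c : ℂ) (τ : Fin 2)
    (hF : ∀ k : FreqMomentum L M, F' ω' k = 1 + (Dm.eval (latticeMomentum L k.2) : ℂ) * (c * Ψ (k, τ))) {N_D ρ : ℝ}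
    (hND : ∑ z : TorusSite 2 L, ‖framePosKernel L Dm z‖ ≤ N_D)
    (hρ : ∑ a : TorusSite 1 (2 * M), ∑ bv : TorusSite 2 L, ‖∑ q₀ : TorusSite 1 (2 * M), ∑ qv : TorusSite 2 L,
      torusChar q₀ a * torusChar qv bv * gridSymbol L M (2 * M) β Ψ τ q₀ qv‖ ≤ ρ)
    (σ cc : Fin 2) (x : SpaceTimeIdx L M) :
    ∑ y : SpaceTimeIdx L M, ‖(sectorAnalysisMatrix L M β F' * sectorSubMatrix L M β (trivialMultiplier L M)) (y, ((ω', σ), cc)) (x, ((0, σ), cc))‖ ≤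
      (imagTimeWeight β M)⁻¹ + ‖c‖ * (β * (L : ℝ) ^ 2) * N_D * ρ := by
  have hL : (0 : ℝ) < (L : ℝ) ^ 2 := by have := NeZero.pos L; positivity
  have hM : (0 : ℝ) < M := Nat.cast_pos.2 (NeZero.pos M)
  have hc0 : (0 : ℝ) < β * (L : ℝ) ^ 2 := by positivity
  rw [colSum_overlapKernel_eq hβ]
  have hsym : ∀ q : TorusSite 1 (2 * M) × TorusSite 2 L,
      F' ω' (⟨(q.1 0).val, ZMod.val_lt (q.1 0)⟩, q.2) * trivialMultiplier L M 0 (⟨(q.1 0).val, ZMod.val_lt (q.1 0)⟩, q.2) =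
        (1 : ℂ) + (Dm.eval (latticeMomentum L q.2) : ℂ) * (c * Ψ ((⟨(q.1 0).val, ZMod.val_lt (q.1 0)⟩, q.2), τ)) := by
    intro q; rw [hF, trivialMultiplier, mul_one]
  simp_rw [hsym]
  have hone : ∑ z : TorusSite 1 (2 * M) × TorusSite 2 L, ‖∑ q : TorusSite 1 (2 * M) × TorusSite 2 L, (torusChar q.1 z.1 * torusChar q.2 z.2) • (1 : ℂ)‖ =
      ((2 * M : ℕ) : ℝ) * (L : ℝ) ^ 2 := KLRegimeSplit.sum_norm_sum_prodTorusChar_eq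
  have hadd := sum_norm_charSum_add_le (M := M) (L := L) (fun _ => (1 : ℂ))
    (fun q : TorusSite 1 (2 * M) × TorusSite 2 L => (Dm.eval (latticeMomentum L q.2) : ℂ) * (c * Ψ ((⟨(q.1 0).val, ZMod.val_lt (q.1 0)⟩, q.2), τ)))
  have hmain := sum_norm_charSum_evalMul_le hβ.ne' Dm Ψ c τ hND hρ
  have hL1 : (L : ℝ) ≠ 0 := by exact_mod_cast NeZero.ne L
  have hε : (imagTimeWeight β M)⁻¹ = 1 / (β * (L : ℝ) ^ 2) * (((2 * M : ℕ) : ℝ) * (L : ℝ) ^ 2) := by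
    rw [imagTimeWeight, inv_div]; push_cast; field_simp
  rw [hε]
  calc 1 / (β * (L : ℝ) ^ 2) * _ ≤ 1 / (β * (L : ℝ) ^ 2) * (((2 * M : ℕ) : ℝ) * (L : ℝ) ^ 2 + ‖c‖ * (β * (L : ℝ) ^ 2) ^ 2 * N_D * ρ) := by
        refine mul_le_mul_of_nonneg_left (hadd.trans ?_) (by positivity)
        rw [hone]
        exact add_le_add le_rfl hmain
    _ = 1 / (β * (L : ℝ) ^ 2) * (((2 * M : ℕ) : ℝ) * (L : ℝ) ^ 2) + ‖c‖ * (β * (L : ℝ) ^ 2) * N_D * ρ := by field_simp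

end Overlap

/-! ## §3 The chain symbol below temperature: `κ_D/(1+Ψ_{K₂}κ_D) − κ_D = −κ_D²·Ψ_{K₁}`, and its pin character sum `≤ N_D²·ρ/2` -/

section Chain

variable {L M : ℕ} [NeZero L] [NeZero M]

/-- **The character sum of (polynomial spatial multiplier)² × (scalar) × (symbol)** is at most `‖c‖·(βL²)²·N_D²·ρ` (Young on the spatial torus for the square).
[cite: BenfattoGiulianiMastropietro2006, §3 (3.3)] -/
theorem sum_norm_charSum_evalSqMul_le {β : ℝ} (hβ : β ≠ 0) (Dm : TrigPolyC4v) (Ψ : FreqMomentum L M × Fin 2 → ℂ) (c : ℂ) (τ : Fin 2) {N_D ρ : ℝ}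
    (hND : ∑ z : TorusSite 2 L, ‖framePosKernel L Dm z‖ ≤ N_D)
    (hρ : ∑ a : TorusSite 1 (2 * M), ∑ bv : TorusSite 2 L, ‖∑ q₀ : TorusSite 1 (2 * M), ∑ qv : TorusSite 2 L,
      torusChar q₀ a * torusChar qv bv * gridSymbol L M (2 * M) β Ψ τ q₀ qv‖ ≤ ρ) :
    ∑ z : TorusSite 1 (2 * M) × TorusSite 2 L, ‖∑ q : TorusSite 1 (2 * M) × TorusSite 2 L, (torusChar q.1 z.1 * torusChar q.2 z.2) •
        (((Dm.eval (latticeMomentum L q.2) : ℂ) * (Dm.eval (latticeMomentum L q.2) : ℂ)) * (c * Ψ ((⟨(q.1 0).val, ZMod.val_lt (q.1 0)⟩, q.2), τ)))‖ ≤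
      ‖c‖ * (β * (L : ℝ) ^ 2) ^ 2 * N_D ^ 2 * ρ := by
  have hL : (0 : ℝ) < (L : ℝ) ^ 2 := by have := NeZero.pos L; positivity
  have hL1 : (L : ℝ) ≠ 0 := by exact_mod_cast NeZero.ne L
  have hsplit := sum_norm_charSum_spatialMul_le (P := 2 * M)
    (fun kv : TorusSite 2 L => (Dm.eval (latticeMomentum L kv) : ℂ) * (Dm.eval (latticeMomentum L kv) : ℂ))
    (fun q : TorusSite 1 (2 * M) × TorusSite 2 L => c * Ψ ((⟨(q.1 0).val, ZMod.val_lt (q.1 0)⟩, q.2), τ))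
  have hN0 : 0 ≤ N_D := (sum_nonneg fun _ _ => norm_nonneg _).trans hND
  have hD : ((L : ℝ) ^ 2)⁻¹ * ∑ x : TorusSite 2 L, ‖∑ kv : TorusSite 2 L,
      ((Dm.eval (latticeMomentum L kv) : ℂ) * (Dm.eval (latticeMomentum L kv) : ℂ)) * torusChar kv x‖ ≤ N_D ^ 2 := by
    have hY := sum_norm_charSum_eval_mul_eval_le (L := L) Dm Dm
    calc ((L : ℝ) ^ 2)⁻¹ * ∑ x : TorusSite 2 L, ‖∑ kv : TorusSite 2 L,
          ((Dm.eval (latticeMomentum L kv) : ℂ) * (Dm.eval (latticeMomentum L kv) : ℂ)) * torusChar kv x‖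
        ≤ ((L : ℝ) ^ 2)⁻¹ * ((L : ℝ) ^ 2 * (∑ z : TorusSite 2 L, ‖framePosKernel L Dm z‖) * ∑ z : TorusSite 2 L, ‖framePosKernel L Dm z‖) :=
          mul_le_mul_of_nonneg_left hY (by positivity)
      _ = (∑ z : TorusSite 2 L, ‖framePosKernel L Dm z‖) ^ 2 := by field_simp
      _ ≤ N_D ^ 2 := pow_le_pow_left₀ (sum_nonneg fun _ _ => norm_nonneg _) hND 2
  have hΨ : ∑ z : TorusSite 1 (2 * M) × TorusSite 2 L, ‖∑ q : TorusSite 1 (2 * M) × TorusSite 2 L, (torusChar q.1 z.1 * torusChar q.2 z.2) •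
      (c * Ψ ((⟨(q.1 0).val, ZMod.val_lt (q.1 0)⟩, q.2), τ))‖ ≤ ‖c‖ * ((β * (L : ℝ) ^ 2) ^ 2 * ρ) := by
    rw [sum_norm_charSum_const_mul, sum_norm_charSum_eq_mul_gridSymbol_twoM hβ]
    exact mul_le_mul_of_nonneg_left (mul_le_mul_of_nonneg_left hρ (sq_nonneg _)) (norm_nonneg _)
  calc _ ≤ _ := hsplit
    _ = (((L : ℝ) ^ 2)⁻¹ * ∑ x : TorusSite 2 L, ‖∑ kv : TorusSite 2 L,
          ((Dm.eval (latticeMomentum L kv) : ℂ) * (Dm.eval (latticeMomentum L kv) : ℂ)) * torusChar kv x‖) *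
          ∑ z : TorusSite 1 (2 * M) × TorusSite 2 L, ‖∑ q : TorusSite 1 (2 * M) × TorusSite 2 L, (torusChar q.1 z.1 * torusChar q.2 z.2) •
            (c * Ψ ((⟨(q.1 0).val, ZMod.val_lt (q.1 0)⟩, q.2), τ))‖ := by ring
    _ ≤ N_D ^ 2 * (‖c‖ * ((β * (L : ℝ) ^ 2) ^ 2 * ρ)) :=
          mul_le_mul hD hΨ (sum_nonneg fun _ _ => norm_nonneg _) (by positivity)
    _ = ‖c‖ * (β * (L : ℝ) ^ 2) ^ 2 * N_D ^ 2 * ρ := by ring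

variable {β : ℝ} (hβ : 0 < β) (μ : ℝ) (K₁ K₂ : TrigPolyC4v) (e₀ : ℝ) (n : ℕ)
  (hΛ : 0 < klScale e₀ n) (hΛβ : klScale e₀ n ≤ Real.pi / β)
include hβ hΛ hΛβ

omit [NeZero M] in
/-- **The chain symbol below temperature**: with `d = κ_D(k) = D(p_k⃗)/(βL²)` (as a complex number), `Ψ_K = uvSymbolCT … K Λ_n`, `0 < Λ_n ≤ π/β`:
`d/(1 + Ψ_{K₂}(k,σ)·d) − d = −(d·d·Ψ_{K₁}(k,σ))` — the symbol `κ_D/(1+Ψκ_D) − κ_D` of `…TwoVolumeFrameChainRows.effAction_counterQuadratic_sub_eq_diagQuad` is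
`−κ_D²` times the frame-`K₁` symbol, EXACTLY (k3c4-p2's `Ψ̃ = Ψ_{K₁}`). [cite: FeldmanSalmhoferTrubowitz1996, §1] -/
theorem chainSymbol_eq_of_scale_le_pi_div (ks : FreqMomentum L M × Fin 2) :
    (((fsub K₂ K₁).eval (latticeMomentum L ks.1.2) / (β * (L : ℝ) ^ 2) : ℝ) : ℂ) /
          (1 + uvSymbolCT L M β μ K₂ (klScale e₀ n) ks * (((fsub K₂ K₁).eval (latticeMomentum L ks.1.2) / (β * (L : ℝ) ^ 2) : ℝ) : ℂ)) -
        (((fsub K₂ K₁).eval (latticeMomentum L ks.1.2) / (β * (L : ℝ) ^ 2) : ℝ) : ℂ) =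
      -((((fsub K₂ K₁).eval (latticeMomentum L ks.1.2) / (β * (L : ℝ) ^ 2) : ℝ) : ℂ) *
        (((fsub K₂ K₁).eval (latticeMomentum L ks.1.2) / (β * (L : ℝ) ^ 2) : ℝ) : ℂ) * uvSymbolCT L M β μ K₁ (klScale e₀ n) ks) := by
  have hm := dressWeight_sub_one_eq_of_scale_le_pi_div hβ μ K₁ K₂ e₀ n hΛ hΛβ ks
  set d : ℂ := (((fsub K₂ K₁).eval (latticeMomentum L ks.1.2) / (β * (L : ℝ) ^ 2) : ℝ) : ℂ) with hd
  calc d / (1 + uvSymbolCT L M β μ K₂ (klScale e₀ n) ks * d) - d = d * ((1 + uvSymbolCT L M β μ K₂ (klScale e₀ n) ks * d)⁻¹ - 1) := by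
        rw [div_eq_mul_inv]; ring
    _ = d * -(d * uvSymbolCT L M β μ K₁ (klScale e₀ n) ks) := by rw [hm]
    _ = _ := by ring

/-- **The pin character sum of the chain symbol is `≤ N_D²·ρ/2`**: at base point `x₀`, spin `σ`, with `N_D ≥ Σ_z‖Ď(z)‖` and `ρ ≥` the grid character sum (at
`N = 2M`, spin `σ`) of `Ψ_{K₁}` at `Λ_n ≤ π/β`,
`Σ_{x₁} ‖Σ_k ((κ_D/(1+Ψ_{K₂}κ_D) − κ_D)·(2!)⁻¹)·e^{iω_k(t₁−t₀)}χ_{k⃗}(x⃗₁−x⃗₀)‖ ≤ N_D²·ρ/2` — the named datum `Xχ` of `…DualRowsLastScaleConversion.hPe_lastScale_le`.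
[cite: BenfattoGiulianiMastropietro2006, §2.3 (2.21)–(2.24), §3 (3.3)] -/
theorem sum_norm_chainCharSum_le {N_D ρ : ℝ} (hND : ∑ z : TorusSite 2 L, ‖framePosKernel L (fsub K₂ K₁) z‖ ≤ N_D) (σ : Fin 2)
    (hρ : ∑ a : TorusSite 1 (2 * M), ∑ bv : TorusSite 2 L, ‖∑ q₀ : TorusSite 1 (2 * M), ∑ qv : TorusSite 2 L,
      torusChar q₀ a * torusChar qv bv * gridSymbol L M (2 * M) β (uvSymbolCT L M β μ K₁ (klScale e₀ n)) σ q₀ qv‖ ≤ ρ)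
    (x₀ : SpaceTimeIdx L M) :
    ∑ x₁ : SpaceTimeIdx L M, ‖∑ k : FreqMomentum L M,
        ((((fsub K₂ K₁).eval (latticeMomentum L k.2) / (β * (L : ℝ) ^ 2) : ℝ) : ℂ) /
              (1 + uvSymbolCT L M β μ K₂ (klScale e₀ n) (k, σ) * (((fsub K₂ K₁).eval (latticeMomentum L k.2) / (β * (L : ℝ) ^ 2) : ℝ) : ℂ)) -
            (((fsub K₂ K₁).eval (latticeMomentum L k.2) / (β * (L : ℝ) ^ 2) : ℝ) : ℂ)) * (((2 : ℕ).factorial : ℚ)⁻¹ • (1 : ℂ)) *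
          (Complex.exp (((matsubaraFreq β M k.1 * (imagTime β M x₁.1 - imagTime β M x₀.1) : ℝ) : ℂ) * I) * torusChar k.2 (x₁.2 - x₀.2))‖ ≤
      N_D ^ 2 * ρ / 2 := by
  have hL : (0 : ℝ) < (L : ℝ) ^ 2 := by have := NeZero.pos L; positivity
  have hL1 : (L : ℝ) ≠ 0 := by exact_mod_cast NeZero.ne L
  have hc0 : (0 : ℝ) < β * (L : ℝ) ^ 2 := by positivity
  rw [sum_norm_pinCharSum_eq hβ.ne']
  -- the symbol is `D(p)² · (c · Ψ_{K₁})` with `c = −(βL²)⁻²/2`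
  set c : ℂ := -((((1 / (β * (L : ℝ) ^ 2) : ℝ) : ℂ)) ^ 2 * (((2 : ℕ).factorial : ℚ)⁻¹ • (1 : ℂ))) with hc
  have hsym : ∀ q : TorusSite 1 (2 * M) × TorusSite 2 L,
      ((((fsub K₂ K₁).eval (latticeMomentum L q.2) / (β * (L : ℝ) ^ 2) : ℝ) : ℂ) /
            (1 + uvSymbolCT L M β μ K₂ (klScale e₀ n) ((⟨(q.1 0).val, ZMod.val_lt (q.1 0)⟩, q.2), σ) *
              (((fsub K₂ K₁).eval (latticeMomentum L q.2) / (β * (L : ℝ) ^ 2) : ℝ) : ℂ)) -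
          (((fsub K₂ K₁).eval (latticeMomentum L q.2) / (β * (L : ℝ) ^ 2) : ℝ) : ℂ)) * (((2 : ℕ).factorial : ℚ)⁻¹ • (1 : ℂ)) =
        (((fsub K₂ K₁).eval (latticeMomentum L q.2) : ℂ) * ((fsub K₂ K₁).eval (latticeMomentum L q.2) : ℂ)) *
          (c * uvSymbolCT L M β μ K₁ (klScale e₀ n) ((⟨(q.1 0).val, ZMod.val_lt (q.1 0)⟩, q.2), σ)) := by
    intro q
    have h := chainSymbol_eq_of_scale_le_pi_div hβ μ K₁ K₂ e₀ n hΛ hΛβ ((⟨(q.1 0).val, ZMod.val_lt (q.1 0)⟩, q.2), σ)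
    simp only at h
    rw [h, hc]
    push_cast
    ring
  simp_rw [hsym]
  have hmain := sum_norm_charSum_evalSqMul_le hβ.ne' (fsub K₂ K₁) (uvSymbolCT L M β μ K₁ (klScale e₀ n)) c σ hND hρ
  have hnc : ‖c‖ * (β * (L : ℝ) ^ 2) ^ 2 = 1 / 2 := by
    rw [hc, norm_neg, norm_mul, norm_pow, Complex.norm_real, Real.norm_eq_abs, abs_of_pos (by positivity)]
    have h2 : ‖(((2 : ℕ).factorial : ℚ)⁻¹ • (1 : ℂ))‖ = 1 / 2 := by
      rw [Nat.factorial_two]; norm_num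
    rw [h2]
    field_simp
  calc _ ≤ ‖c‖ * (β * (L : ℝ) ^ 2) ^ 2 * N_D ^ 2 * ρ := hmain
    _ = N_D ^ 2 * ρ / 2 := by rw [hnc]; ring

end Chain

end Summit.HubbardSuperconductivity.HubbardSuperconductivity.Theorems.TwoVolumeDefect

end
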